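/-
COR-CM (cell pub-hodgecm2, stage 2 of the Hodge ladder) — count-neutral KERNEL brick WITNESS-FORM (seat prover-pub-hodgecm2-b07-g35-0,
binder prover b07, gen 35; claim HOME/lit/LIT-STATUS.md 2026-08-21T10:54:04Z, INBOX l.3490; sequel of `CorCM/PeriodCharacterTransport.lean`,
p262357).  Theorems only; no definition, no named fact, nothing asserted.  NOT an E term and NOT a display of record: no new constant of
type `HC_CM_of_PerLFace` (RULING E-DEDUP); `Interfaces.lean` (C1), `Assembly/ModelChain*.lean` (E term p238778, displays F2 p244999 /
F3 p247019) untouched and only imported BY NAME; the wording of record is not affected.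
-/
import Summits.HodgeConjecture.CorCM.PeriodCharacterTransport
import Summits.HodgeConjecture.CorCM.Assembly.ModelChainClosedH1
import HarnessLib

/-!
# `HC_CM` from face-period WITNESSES: the binders `∀ ι₁`, `∀ V` and "eigen-embedding `= ι₁`" of `PerLFace` are idle for `HC_CM`

The face-form period theorem `Universe.PeriodThmF` (`= PerLFace`, the displayed hypothesis of the stage-2 E term) asks, for every
Galois CM field `F` with `[F:ℚ] ≥ 6` and every rank-four face `f`, for a non-zero face period on the compact Picard modular surfaces
`P_Γ(V)` of EVERY hermitian 3-space `V` of signature `(2,1)` at EVERY admissible place `ι₁`, with `ι₁`-eigen one-forms.  The chain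
`PerLFace ⟹ W_RK4 ⟹ HC_CM` of this cell (`Assembly.w_rk4_of`, `CorCM/Assembly/CorCM.lean`; `Assembly.hc_cm_of_periodThmF`) consumes
it at ONE admissible `ι₁` (`StubTree.admissible_exists`) and ONE `V` (Landherr, `landherr_exists_proof`) per face — the surface
criterion rfwf Prop. 2.2 (`Universe.surfaceCriterion_holds`) needs a single surface — and `CorCM/PeriodCharacterTransport.lean`
(`Universe.periodNV_of_periodNV_of_forall_mem`) moves a period witness at any eigen-embedding `σ` to the admissible `ι₁`.

Hence the following WITNESS FORM already gives `W_RK4`, and with the rest of the model chain `HC_CM`: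

  for every Galois CM field `F` with `[F:ℚ] ≥ 6` and every face `f` of `F` there are an admissible embedding `ι₁`, a hermitian
  3-space `V` of signature `(2,1)` at `ι₁`, an embedding `σ`, a level `Γ`, morphisms `F_i : P_Γ(V) → A_{(F,ψ_i(f))}` and holomorphic
  `σ`-eigen one-forms `α_i` with `∫_{P_Γ} F₀^*α₀ ∧ F₁^*α₁ ∧ \overline{F₂^*α₂ ∧ F₃^*α₃} ≠ 0`

(stated UNFOLDED below as `∀ F, … ∀ f, ∃ ι₁, f.Admissible ι₁ ∧ ∃ V σ, U.PeriodNV ι₁ V F f.psi σ`; no new `Prop` definition).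

* `Universe.w_rk4_of_exists_periodNV` — witnesses ⟹ `W_RK4`, on any universe with `Fact_eigenLine`, `Fact_alphaLine`,
  `SurfaceCriterion`, `PmsDimTwo` (Landherr and `AdmissibleExists` are not needed in this direction);
  `Universe.facePeriodWitness_of_periodThmF` — `PeriodThmF` ⟹ witnesses (Landherr + `admissible_exists`, both kernel).
* `Assembly.hc_cm_of_exists_periodNV` — `Assembly.hc_cm_of_periodThmF` with the witness hypothesis in place of `PeriodThmF`.
* `Model.hc_cm_of_rows_of_exists_periodNV`, `Model.chainR_of_exists_periodNV` — the same on the model universe (rows M22 / F7 by the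
  tree theorems `Model.universeOf_algDuality`, `Model.universeOf_fact_gysin`, exactly as in `Model.chainR`).
* `hc_cm_of_exists_facePeriod` — `∀ hHD hI h₁ h₃, witnesses(U_rec) → DeligneMilne1982_Thm_6_20_full → HC_CM`;
  `hc_cm_closed_of_exists_facePeriod` — all five data instantiated by tree theorems (the pattern of display F3
  `hc_cm_closed_of_perLFace`); `exists_facePeriod_of_perLFace` — F3's hypothesis implies this file's.

READING (planning input for the junction B01, nothing displayed changes): the `∀ V` collapse (row `TowerDominance` of the ideation memo
IDEA-1g) and the relabelling of towers (row `TowerRelabel`) serve the LITERAL TYPE of B01 `PerLFace_of_PerL`; the Hodge conjecture for CM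
abelian varieties needs only one period witness per face.

STATUS OF THIS FILE (lead gen 6 ruling, HOME/INBOX.md l.3508, conditions (i)–(iv)), verbatim:
«not a display of record — the displays of record are Assembly/ModelChain*.lean; wording of record unchanged».
Its theorems are BY-NAME planning input for the junction owner (own-b01); a witness-form junction in place of `PerLFace` would be a NEW
junction needing a lead ruling and the referees' countersign; until then B01's literal type (C3) is the row and the only live junction.

References: rfwf v3 Prop. 2.2 / Thm 1.3 / §4.2 (the surface criterion consumes one surface per face); W. Landherr, *Äquivalenz Hermitescher
Formen über einem beliebigen algebraischen Zahlkörper*, Abh. Math. Sem. Hamburg 11 (1936) (existence of the hermitian space, used only in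
the converse direction); P. Deligne, J. S. Milne, *Tannakian Categories*, LNM 900 (1982) §6 Thm. 6.20; G. Shimura, *Abelian Varieties with
Complex Multiplication and Modular Functions* (1998) §6.2 Thm. 3.
-/

noncomputable section

open NumberField
open Literature.AlgebraicGeometry.Motives (CMType)
open Literature.AlgebraicGeometry.HodgeTheory
open Literature.NumberTheory.Automorphic.PicardCM

namespace Summit.HodgeConjecture.CorCM

namespace Universe

variable {U : Universe}

/-- **Face-period witnesses give `W^{RK4}`.**  On a universe with one-dimensional CM eigenlines (`Fact_eigenLine`), the CM-type
condition (`Fact_alphaLine`), the surface criterion rfwf Prop. 2.2 and `dim P_Γ = 2`: if every face of every Galois CM field of degree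
`≥ 6` has a non-zero period on SOME compact Picard modular surface (some admissible place `ι₁`, some hermitian space `V`, some level) with
eigenforms at SOME embedding `σ`, then every rank-four Weil line `W_F(P(f))` is algebraic.  (Transport `σ ↦ ι₁` by
`periodNV_of_periodNV_of_forall_mem`, then the surface criterion on `S = P_Γ(V)`.) -/
theorem w_rk4_of_exists_periodNV (hE : U.Fact_eigenLine) (hA : U.Fact_alphaLine) (h22 : U.SurfaceCriterion)
    (hdim : U.PmsDimTwo)
    (h : ∀ (F : CMField), IsGalois ℚ F → 6 ≤ Module.finrank ℚ F → ∀ f : Face F,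
      ∃ ι₁ : F →+* ℂ, f.Admissible ι₁ ∧ ∃ (V : HermSpace3 F ι₁) (σ : F →+* ℂ), U.PeriodNV ι₁ V F f.psi σ) :
    U.W_RK4 := by
  intro F hG h6 f
  obtain ⟨ι₁, hι, V, σ, hσ⟩ := h F hG h6 f
  obtain ⟨Γ, Fm, α, hα, hper⟩ := periodNV_of_periodNV_of_forall_mem hE hA (admissible_mem_psi f ι₁ hι) hσ
  exact h22 F hG f ι₁ hι (U.pms F ι₁ V Γ) (hdim F ι₁ V Γ) Fm α hα hper

/-- The converse direction of the hypotheses (trivial): `PeriodThmF` gives a face-period witness for every face — at any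
admissible embedding (`StubTree.admissible_exists`, rfwf's `2g ≥ 6` normalisation) and any hermitian space (Landherr,
`landherr_exists_proof`), with `σ = ι₁`. -/
theorem facePeriodWitness_of_periodThmF (h : U.PeriodThmF) :
    ∀ (F : CMField), IsGalois ℚ F → 6 ≤ Module.finrank ℚ F → ∀ f : Face F,
      ∃ ι₁ : F →+* ℂ, f.Admissible ι₁ ∧ ∃ (V : HermSpace3 F ι₁) (σ : F →+* ℂ), U.PeriodNV ι₁ V F f.psi σ := by
  intro F hG h6 f
  obtain ⟨ι₁, hι⟩ := StubTree.admissible_exists F h6 f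
  obtain ⟨V⟩ := landherr_exists_proof F ι₁
  exact ⟨ι₁, hι, V, ι₁, h F hG h6 f ι₁ hι V⟩

/-- With `Fact_eigenLine` and `Fact_alphaLine`, `W^{RK4}`-relevant content of `PeriodThmF` is exactly the witness form: `PeriodThmF`
implies it, and it implies `W_RK4` under the surface criterion (the two previous theorems; recorded as one statement). -/
theorem w_rk4_of_periodThmF_iff_witness (hE : U.Fact_eigenLine) (hA : U.Fact_alphaLine) (h22 : U.SurfaceCriterion)
    (hdim : U.PmsDimTwo) :
    (U.PeriodThmF → U.W_RK4) ∧
      ((∀ (F : CMField), IsGalois ℚ F → 6 ≤ Module.finrank ℚ F → ∀ f : Face F,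
        ∃ ι₁ : F →+* ℂ, f.Admissible ι₁ ∧ ∃ (V : HermSpace3 F ι₁) (σ : F →+* ℂ), U.PeriodNV ι₁ V F f.psi σ) → U.W_RK4) :=
  ⟨fun hP => w_rk4_of_exists_periodNV hE hA h22 hdim (facePeriodWitness_of_periodThmF hP),
    w_rk4_of_exists_periodNV hE hA h22 hdim⟩

end Universe

namespace Assembly

open Universe StubTree

variable (U : Universe)

/-- **COR-CM from face-period witnesses** — `Assembly.hc_cm_of_periodThmF` with the witness hypothesis in place of `PeriodThmF`:
for a universe satisfying the 28 model facts `ModelAxioms` and the textbook facts N1–N4, F2, F4–F7, one non-zero face period per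
face (some admissible place, some hermitian space, some level, some eigen-embedding) implies `HC_CM`: witnesses ⟹ (`σ ↦ ι₁`,
surface criterion) `W^{RK4}` ⟹ (Pohlmann + [QW8] Thm 2.5) `FaceReduction` ⟹ (rfwf Lemma 8.2) `HC_CM`. -/
theorem hc_cm_of_exists_periodNV (M : U.ModelAxioms)
    (h : ∀ (F : CMField), IsGalois ℚ F → 6 ≤ Module.finrank ℚ F → ∀ f : Face F,
      ∃ ι₁ : F →+* ℂ, f.Admissible ι₁ ∧ ∃ (V : HermSpace3 F ι₁) (σ : F →+* ℂ), U.PeriodNV ι₁ V F f.psi σ)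
    (hN1 : U.Fact_cupExterior) (hN2 : U.Fact_cup_hodge) (hN3 : U.Fact_pull_H0) (hN4 : U.Fact_hodge_F0)
    (h2 : U.Fact_factorActDescends) (h4 : U.Fact_cupAlg) (h5 : U.Fact_cupAssoc) (h6 : U.Fact_weightDual)
    (h7 : U.Fact_gysin) : U.HC_CM :=
  hc_cm_of U
    (Universe.w_rk4_of_exists_periodNV M.eigenLine M.alphaLine (Universe.surfaceCriterion_holds M) M.pms_dim h)
    (faceReduction_holds U (U.pohlmannSpan_of_facts M hN1 hN2 hN3 hN4)
      (U.qw8Sufficiency_of_geometricFacts M hN1 hN2 hN3 hN4 h2 h4 h5 h6 h7))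
    (lemma81_holds U M)

end Assembly

namespace Model

/-- **The model chain from witnesses, rows M22 and F7 as hypotheses** (the pattern of `Model.hc_cm_of_rows`): on the model universe
`universeOf hHD hI hU h₃`, Deligne–Milne 1982 Thm 6.20 (`hR`), `Fact_algDuality` (`h28`), `Fact_gysin` (`hF7`) and one face-period
witness per face imply `U.HC_CM`. -/
theorem hc_cm_of_rows_of_exists_periodNV (hHD : exists_isReal_hodgeModel) (hI : hodgePQ_independent_of_hodgeModel)
    (hU : BallQuotientUniformisedDatum) (h₃ : CMAbelianVarietyRealised) (hR : DeligneMilne1982_Thm_6_20_full)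
    (h28 : (universeOf hHD hI hU h₃).Fact_algDuality) (hF7 : (universeOf hHD hI hU h₃).Fact_gysin)
    (h : ∀ (F : CMField), IsGalois ℚ F → 6 ≤ Module.finrank ℚ F → ∀ f : Face F,
      ∃ ι₁ : F →+* ℂ, f.Admissible ι₁ ∧ ∃ (V : HermSpace3 F ι₁) (σ : F →+* ℂ), (universeOf hHD hI hU h₃).PeriodNV ι₁ V F f.psi σ) :
    (universeOf hHD hI hU h₃).HC_CM :=
  Assembly.hc_cm_of_exists_periodNV (universeOf hHD hI hU h₃) (modelAxioms_of_rows hHD hI hU h₃ hR h28) h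
    (universeOf_fact_cupExterior hHD hI hU h₃) (universeOf_fact_cup_hodge hHD hI hU h₃)
    (universeOf_fact_pull_H0 hHD hI hU h₃) (universeOf_fact_hodge_F0 hHD hI hU h₃)
    (universeOf_fact_factorActDescends hHD hI hU h₃ (modelAxioms_of_rows hHD hI hU h₃ hR h28))
    (universeOf_fact_cupAlg hHD hI hU h₃) (universeOf_fact_cupAssoc hHD hI hU h₃)
    (universeOf_fact_weightDual hHD hI hU h₃ (modelAxioms_of_rows hHD hI hU h₃ hR h28)) hF7

/-- **The model chain from witnesses, CLOSED rows** (the pattern of `Model.chainR`: M22 = `universeOf_algDuality`, F7 =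
`universeOf_fact_gysin`): for every instance of the universe of record, Deligne–Milne 1982 Thm 6.20 and one face-period witness per
face imply `U.HC_CM`. -/
theorem chainR_of_exists_periodNV (hHD : exists_isReal_hodgeModel) (hI : hodgePQ_independent_of_hodgeModel)
    (h₁ : BallQuotientUniformised) (h₃ : CMAbelianVarietyRealised) (hR : DeligneMilne1982_Thm_6_20_full)
    (h : ∀ (F : CMField), IsGalois ℚ F → 6 ≤ Module.finrank ℚ F → ∀ f : Face F,
      ∃ ι₁ : F →+* ℂ, f.Admissible ι₁ ∧ ∃ (V : HermSpace3 F ι₁) (σ : F →+* ℂ),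
        (picardCMUniverse hHD hI h₁ h₃).PeriodNV ι₁ V F f.psi σ) :
    (picardCMUniverse hHD hI h₁ h₃).HC_CM :=
  hc_cm_of_rows_of_exists_periodNV hHD hI (ballQuotientUniformisedDatum_of h₁) h₃ hR
    (universeOf_algDuality hHD hI _ h₃) (universeOf_fact_gysin hHD hI _ h₃) h

/-- On the universe of record the witness form follows from `PerLFace` (trivial direction, recorded for comparison with the E term). -/
theorem facePeriodWitness_of_perLFace (hHD : exists_isReal_hodgeModel) (hI : hodgePQ_independent_of_hodgeModel)
    (h₁ : BallQuotientUniformised) (h₃ : CMAbelianVarietyRealised) (hP : (picardCMUniverse hHD hI h₁ h₃).PerLFace) :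
    ∀ (F : CMField), IsGalois ℚ F → 6 ≤ Module.finrank ℚ F → ∀ f : Face F,
      ∃ ι₁ : F →+* ℂ, f.Admissible ι₁ ∧ ∃ (V : HermSpace3 F ι₁) (σ : F →+* ℂ),
        (picardCMUniverse hHD hI h₁ h₃).PeriodNV ι₁ V F f.psi σ :=
  Universe.facePeriodWitness_of_periodThmF hP

end Model

/-- **`HC_CM` from face-period witnesses on the universe of record** (the shape of the E term `hc_cm_of_PerLFace` with the WEAKER
hypothesis): for every instance `hHD hI h₁ h₃` of the Picard–CM model universe, one non-zero face period per face of every Galois CM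
field of degree `≥ 6` — at some admissible place, on some hermitian space, at some level, with eigenforms at some embedding — together
with Deligne–Milne 1982 Thm 6.20 implies the Hodge conjecture for every complex abelian variety of CM type (`HC_CM`, BY NAME).
Arrow A3 in Riemann form (`hc_cm_of_model_hc_cm_riemann`). -/
theorem hc_cm_of_exists_facePeriod (hHD : exists_isReal_hodgeModel) (hI : hodgePQ_independent_of_hodgeModel)
    (h₁ : BallQuotientUniformised) (h₃ : CMAbelianVarietyRealised)
    (h : ∀ (F : CMField), IsGalois ℚ F → 6 ≤ Module.finrank ℚ F → ∀ f : Face F,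
      ∃ ι₁ : F →+* ℂ, f.Admissible ι₁ ∧ ∃ (V : HermSpace3 F ι₁) (σ : F →+* ℂ),
        (Model.picardCMUniverse hHD hI h₁ h₃).PeriodNV ι₁ V F f.psi σ)
    (hR : DeligneMilne1982_Thm_6_20_full) : HC_CM :=
  hc_cm_of_model_hc_cm_riemann hHD hI h₁ h₃ hR (Model.chainR_of_exists_periodNV hHD hI h₁ h₃ hR h)

/-- **`HC_CM` from face-period witnesses alone** (the pattern of display F3 `hc_cm_closed_of_perLFace`: `hHD`, `hI`, `h₁`, `h₃`, `hR`
are the tree theorems `exists_isReal_hodgeModel_holds`, `hodgePQ_independent_of_hodgeModel_holds`,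
`BallQuotient.ballQuotientUniformised_holds`, `cmAbelianVarietyRealised_holds`, `deligneMilne1982_Thm_6_20_full_holds`): if every face of
every Galois CM field of degree `≥ 6` has one non-zero period on some compact Picard modular surface of the universe of record, the Hodge
conjecture holds for every complex abelian variety of CM type. -/
theorem hc_cm_closed_of_exists_facePeriod
    (h : ∀ (F : CMField), IsGalois ℚ F → 6 ≤ Module.finrank ℚ F → ∀ f : Face F,
      ∃ ι₁ : F →+* ℂ, f.Admissible ι₁ ∧ ∃ (V : HermSpace3 F ι₁) (σ : F →+* ℂ),
        (Model.picardCMUniverse exists_isReal_hodgeModel_holds hodgePQ_independent_of_hodgeModel_holds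
          BallQuotient.ballQuotientUniformised_holds cmAbelianVarietyRealised_holds).PeriodNV ι₁ V F f.psi σ) : HC_CM :=
  hc_cm_of_exists_facePeriod _ _ _ _ h deligneMilne1982_Thm_6_20_full_holds

/-- The hypothesis of display F3 (`PerLFace` of the universe of record at the four tree theorems) implies the hypothesis of
`hc_cm_closed_of_exists_facePeriod`; so F3 factors through this file (the converse implication between the two HYPOTHESES is the
`∀ V` / `∀ ι₁` collapse and is not claimed here). -/
theorem exists_facePeriod_of_perLFace
    (hP : (Model.picardCMUniverse exists_isReal_hodgeModel_holds hodgePQ_independent_of_hodgeModel_holds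
      BallQuotient.ballQuotientUniformised_holds cmAbelianVarietyRealised_holds).PerLFace) :
    ∀ (F : CMField), IsGalois ℚ F → 6 ≤ Module.finrank ℚ F → ∀ f : Face F,
      ∃ ι₁ : F →+* ℂ, f.Admissible ι₁ ∧ ∃ (V : HermSpace3 F ι₁) (σ : F →+* ℂ),
        (Model.picardCMUniverse exists_isReal_hodgeModel_holds hodgePQ_independent_of_hodgeModel_holds
          BallQuotient.ballQuotientUniformised_holds cmAbelianVarietyRealised_holds).PeriodNV ι₁ V F f.psi σ :=
  Universe.facePeriodWitness_of_periodThmF hP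

/- Consistency check (an `example`, not a constant): display F3 recovered through the witness form. -/
example
    (hP : (Model.picardCMUniverse exists_isReal_hodgeModel_holds hodgePQ_independent_of_hodgeModel_holds
      BallQuotient.ballQuotientUniformised_holds cmAbelianVarietyRealised_holds).PerLFace) : HC_CM :=
  hc_cm_closed_of_exists_facePeriod (exists_facePeriod_of_perLFace hP)

end Summit.HodgeConjecture.CorCM

end
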